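import Literature.Claims.NS.Alneel2026
import Literature.Analysis.FluidPDE.SobolevWholeSpace
import Literature.Analysis.FluidPDE.TaoEnstrophyLocalisationProofs
import Literature.Analysis.FluidPDE.PoincareBall
import HarnessLib

/-!
# Solo salvage for claim C156 `Alneel2026` (cell `ns-claims`, D-0090): the TRUE classical displays of
# Steps 3–4 (p. 2), kernel

Claim skeleton: `Literature/Claims/NS/Alneel2026.lean` (Abd Almomen Alneel Adam Mohamed, Zenodo 21706638,
3 pp.; typist `ns-claims-typist-3` g6, p528876). This file (seat `ns-claims-salvage-p3` g5) proves,
records-grade and off the verdict (the token is the refuter's, `ns-claims-refuter-8` g4):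

* `step4_holds : Step4_Holder` — Step 4 p. 2 l. 33–42 «By Hölder on `B_R`: `‖v‖⁴_{L⁴} ≥ |B_R|⁻¹‖v‖⁴_{L²}`»
  exactly as typed: `(∫_{B(x₀,R)} |v|²)² ≤ |B(x₀,R)| · ∫ |v|⁴` in `[0,∞]`, for EVERY field (no measurability:
  Cauchy–Schwarz is applied to a measurable minorant with the same lower integral);
* `step3_GN_3D_holds : ∃ C, Step3_GN_3D C` — the charity-corrected 3-D face of Step 3 p. 2 l. 26–29
  (REF flag (b′)), Ladyzhenskaya's inequality `‖v‖²_{L⁴} ≤ C‖v‖^{1/2}_{L²}‖∇v‖^{3/2}_{L²}` for smooth compactly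
  supported vector fields on `ℝ³` with the FROBENIUS gradient square `∫|∇v|² = ∫ Σᵢⱼ(∂ᵢvⱼ)²` of the
  skeleton, constant `C = K^{3/2}` with `K` Mathlib's Gagliardo–Nirenberg–Sobolev constant
  (`MeasureTheory.SNormLESNormFDerivOfEqConst`); from the tree's whole-space integral form
  `Literature.Analysis.FluidPDE.integral_norm_pow_four_le_of_integrable` (`∫‖v‖⁴ ≤ K³(∫‖v‖²)^{1/2}(∫‖Dv‖²)^{3/2}`,
  operator norm) and `‖Dv‖²_op ≤ |Dv|²_F` (`sq_opNorm_le_frobeniusNormSq`).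

The printed Step 3 display (exponents `(1,1)`, `Step3_GN_asPrinted`) is NOT touched here (refuter's object).
Solo lane (`Theorems/SoloSalvage<Slug>.lean`, no item); records-grade, no token effect.

WHAT THIS IS NOT: not a claim about NS regularity or blow-up; not a claim about any author beyond the
typed locator.
-/

noncomputable section

set_option linter.dupNamespace false

open Set MeasureTheory Filter Metric
open scoped ENNReal NNReal Topology

namespace Summit.NavierStokesRegularity.NavierStokesRegularity.Theorems.Alneel2026Salvage

open Literature.Analysis Literature.Analysis.FluidPDE
open Literature.Claims.NS Literature.Claims.NS.Alneel2026

/-! ## Step 4 — Cauchy–Schwarz on the ball -/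

/-- **Step 4 holds** (p. 2 l. 33–42 «By Hölder on B_R: ‖v‖⁴_{L⁴} ≥ |B_R|⁻¹‖v‖⁴_{L²}»), exactly as typed:
for every field `v : ℝ³ → ℝ³`, centre `x₀` and `R > 0`, `(∫_{B(x₀,R)}|v|²)² ≤ |B(x₀,R)| · ∫_{ℝ³}|v|⁴` in
`[0,∞]`. Cauchy–Schwarz on the ball applied to a measurable minorant of `|v|²` with the same lower
integral (`exists_measurable_le_lintegral_eq`; Cauchy–Schwarz = the tree's
`PoincareBall.sq_lintegral_le_measure_mul_lintegral_sq`), then monotonicity. [cite: Alneel2026, Step 4 p.2 l.33–42] -/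
theorem step4_holds : Step4_Holder := by
  intro v x₀ R _hR
  set μ : Measure E3 := (volume : Measure E3).restrict (ball x₀ R) with hμ
  obtain ⟨g, hgm, hgle, hgeq⟩ := exists_measurable_le_lintegral_eq μ fun y => ‖v y‖ₑ ^ 2
  have hcs := PoincareBall.sq_lintegral_le_measure_mul_lintegral_sq μ hgm.aemeasurable
  have hvol : μ univ = volume (ball x₀ R) := by rw [hμ, Measure.restrict_apply_univ]
  have hmono : ∫⁻ a, g a ^ 2 ∂μ ≤ ∫⁻ y, ‖v y‖ₑ ^ 4 := by
    calc ∫⁻ a, g a ^ 2 ∂μ ≤ ∫⁻ y, (‖v y‖ₑ ^ 2) ^ 2 ∂μ :=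
          lintegral_mono fun y => pow_le_pow_left' (hgle y) 2
      _ = ∫⁻ y in ball x₀ R, ‖v y‖ₑ ^ 4 := by
          rw [hμ]; exact lintegral_congr fun y => by rw [← pow_mul]
      _ ≤ ∫⁻ y, ‖v y‖ₑ ^ 4 := setLIntegral_le_lintegral _ _
  have hgoal : (∫⁻ a, ‖v a‖ₑ ^ 2 ∂μ) ^ 2 ≤ μ univ * ∫⁻ y, ‖v y‖ₑ ^ 4 := by
    rw [hgeq]
    exact hcs.trans (by gcongr)
  rw [hvol, hμ] at hgoal
  exact hgoal

/-! ## Step 3 — the 3-D Gagliardo–Nirenberg (Ladyzhenskaya) face -/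

/-- `|0|²_F = 0`. [folklore] -/
theorem frobeniusNormSq_zero : frobeniusNormSq (0 : E3 →L[ℝ] E3) = 0 := by
  simp [frobeniusNormSq]

/-- **Step 3, 3-D face, holds** (charity-corrected display of p. 2 l. 26–29, REF flag (b′)): with
`C = K^{3/2}`, `K` = Mathlib's Gagliardo–Nirenberg–Sobolev constant of `Ḣ¹(ℝ³) ⊂ L⁶`, every smooth compactly
supported `v : ℝ³ → ℝ³` satisfies `(∫|v|⁴)^{1/2} ≤ C (∫|v|²)^{1/4} (∫|∇v|²_F)^{3/4}` — Ladyzhenskaya's 3-D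
inequality `‖v‖_{L⁴} ≤ C^{1/2}‖v‖_{L²}^{1/4}‖∇v‖_{L²}^{3/4}`. From the tree's integral form
`integral_norm_pow_four_le_of_integrable` (operator-norm gradient) and `‖Dv‖² ≤ |Dv|²_F`.
[cite: Alneel2026, Step 3 p.2 l.26–29] [cite: Evans2010, §5.6.1 Thm. 1–2] -/
theorem step3_GN_3D_holds : ∃ C : ℝ, Step3_GN_3D C := by
  set K : ℝ := (SNormLESNormFDerivOfEqConst E3 (volume : Measure E3) 2 : ℝ) with hK
  have hK0 : 0 ≤ K := NNReal.coe_nonneg _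
  refine ⟨K ^ (3 / 2 : ℝ), ?_⟩
  intro v hv hvc
  have hE : Module.finrank ℝ E3 = 3 := finrank_euclideanSpace_fin
  have hv1 : ContDiff ℝ 1 v := hv.of_le (by exact_mod_cast le_top)
  have hvcont : Continuous v := hv.continuous
  have hDcont : Continuous (fderiv ℝ v) := hv.continuous_fderiv (by simp)
  have hDc : HasCompactSupport (fderiv ℝ v) := hvc.fderiv (𝕜 := ℝ)
  -- integrability of the powers of `‖v‖` and of the two gradient squares
  have hpow : ∀ k : ℕ, k ≠ 0 → Integrable (fun x => ‖v x‖ ^ k) (volume : Measure E3) := fun k hk =>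
    (hvcont.norm.pow k).integrable_of_hasCompactSupport
      (hvc.norm.comp_left (g := fun t : ℝ => t ^ k) (zero_pow hk))
  have hDn : Continuous fun x => ‖fderiv ℝ v x‖ := hDcont.norm
  have hDnc : HasCompactSupport fun x => ‖fderiv ℝ v x‖ := hDc.norm
  have hDnc2 : HasCompactSupport fun x => ‖fderiv ℝ v x‖ ^ 2 :=
    hDnc.comp_left (g := fun t : ℝ => t ^ 2) (by simp)
  have hD2 : Integrable (fun x => ‖fderiv ℝ v x‖ ^ 2) (volume : Measure E3) :=
    (hDn.pow 2).integrable_of_hasCompactSupport hDnc2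
  have hFcont : Continuous fun x => frobeniusNormSq (fderiv ℝ v x) :=
    continuous_frobeniusNormSq_fderiv hv (by simp)
  have hFc : HasCompactSupport fun x => frobeniusNormSq (fderiv ℝ v x) :=
    hDc.comp_left (g := frobeniusNormSq) frobeniusNormSq_zero
  have hF : Integrable (fun x => frobeniusNormSq (fderiv ℝ v x)) (volume : Measure E3) :=
    hFcont.integrable_of_hasCompactSupport hFc
  -- the tree's whole-space `L⁴` inequality (operator norm of the gradient)
  have h4 := integral_norm_pow_four_le_of_integrable (volume : Measure E3) hE hv1 (hpow 2 two_ne_zero)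
    (hpow 6 (by norm_num)) hD2
  set A : ℝ := ∫ x, ‖v x‖ ^ 2 with hA
  set B : ℝ := ∫ x, ‖fderiv ℝ v x‖ ^ 2 with hB
  set B' : ℝ := ∫ x, frobeniusNormSq (fderiv ℝ v x) with hB'
  have hA0 : 0 ≤ A := integral_nonneg fun x => by positivity
  have hB0 : 0 ≤ B := integral_nonneg fun x => by positivity
  have hB'0 : 0 ≤ B' := integral_nonneg fun x => frobeniusNormSq_nonneg _
  have hBB' : B ≤ B' := integral_mono hD2 hF fun x => sq_opNorm_le_frobeniusNormSq _
  have h4' : ∫ x, ‖v x‖ ^ 4 ≤ K ^ 3 * A ^ (1 / 2 : ℝ) * B' ^ (3 / 2 : ℝ) := by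
    refine h4.trans ?_
    have hK3A : 0 ≤ K ^ 3 * A ^ (1 / 2 : ℝ) := by positivity
    exact mul_le_mul_of_nonneg_left (Real.rpow_le_rpow hB0 hBB' (by norm_num)) hK3A
  -- take square roots
  have hs := Real.sqrt_le_sqrt h4'
  have e : Real.sqrt (K ^ 3 * A ^ (1 / 2 : ℝ) * B' ^ (3 / 2 : ℝ)) =
      K ^ (3 / 2 : ℝ) * A ^ (1 / 4 : ℝ) * B' ^ (3 / 4 : ℝ) := by
    rw [Real.sqrt_eq_rpow, Real.mul_rpow (by positivity) (by positivity),
      Real.mul_rpow (by positivity) (by positivity), ← Real.rpow_natCast K 3,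
      ← Real.rpow_mul hK0, ← Real.rpow_mul hA0, ← Real.rpow_mul hB'0]
    norm_num
  rw [e] at hs
  exact hs

end Summit.NavierStokesRegularity.NavierStokesRegularity.Theorems.Alneel2026Salvage

end
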